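import Literature.NumberTheory.QuadraticFields.IdealClassWeightedLatticeSum
import Literature.NumberTheory.QuadraticFields.DedekindZetaReducedForms
import Literature.NumberTheory.LFunctions.ClassGroupCharacterTwist
import HarnessLib

/-!
# Class-group character twists as sums over the reduced forms:
# `Σ_𝔞 ψ(𝔞) f(N𝔞) = ½ Σ_{Q reduced} ψ̄([𝔞_Q]) Σ_{(x,y)} f(Q(x,y))`, and the class-group theta series
# `θ(z;ψ) = Σ_𝒜 ψ(𝒜)θ_𝒜(z) = Σ_n λ_ψ(n)e(nz)` as `½ Σ_Q ψ̄([𝔞_Q]) θ_Q(z)` (Conrey–Iwaniec (2.15)–(2.17))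

Topic `NumberTheory/QuadraticFields`, namespace `Literature.NumberTheory.QuadraticFields.Quadratic`
(continuing `IdealClassWeightedLatticeSum.lean` — the class-by-class dictionary for an arbitrary
weight — and `DedekindZetaReducedForms.lean` — the bijection `reducedForms d_K ≃ Cl(K)`,
`Q ↦ [𝔞_Q]`, and the assembly `ζ_K(s) = ½ Σ_{Q reduced} Z_Q(s)` for the special weight `N𝔞^{−s}`).
Everything here is PROVED (theorems only, no definitions, no named facts).

`K` is an imaginary quadratic field with `d_K = t² + 4m < −4` (integral basis `(1, ω)`,
`ω² = m + tω`; `w_K = 2`), `ψ` a character of `Cl(K)`, `ν_ψ(𝔞) = ψ([𝔞])` (`classGroupCharIdealHom`,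
`0` at `𝔞 = 0`), `λ_ψ(n) = Σ_{N𝔞 = n} ψ([𝔞])` (`twistCount K ν_ψ`, (2.18)); `𝔞_Q = (A, ω − (B + t)/2)`
is the ideal of the reduced form `Q = (A, B, C)` (Cox, Thm. 7.7; `reducedForms_mk0_bijective`). For
any weight `f : ℕ → ℂ` with `f 0 = 0`, absolutely summable along every reduced form:
* `hasSum_classGroupCharIdealHom_mul_weight` —
  **`Σ_𝔞 ψ([𝔞]) f(N𝔞) = ½ Σ_{Q ∈ reducedForms d_K} ψ([𝔞_Q])⁻¹ Σ_{(x,y) ∈ ℤ²} f(Q(x,y))`** (a `HasSum`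
  over all ideals): the ideals `𝔞 ≠ 0` are partitioned by their classes, `[𝔞] = [𝔞_Q]⁻¹` for a unique
  reduced `Q`, there `ψ([𝔞]) = ψ([𝔞_Q])⁻¹`, and the class sum is `½ Σ f(Q(x, −y)) = ½ Σ f(Q(x, y))`;
* `hasSum_twistCount_mul_weight` — regrouped by the norm:
  **`Σ_{n ≥ 1} λ_ψ(n) f(n) = ½ Σ_{Q reduced} ψ([𝔞_Q])⁻¹ Σ_{(x,y)} f(Q(x,y))`**;
* `sum_reducedForms_inv_classGroupCharIdealHom` — `Σ_{Q reduced} ψ([𝔞_Q])⁻¹ = Σ_{𝒜 ∈ Cl(K)} ψ(𝒜)`;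
* `half_sum_add_tsum_twistCount_cexp_eq` — **the class-group theta series as a sum of binary theta
  series**: `½ Σ_𝒜 ψ(𝒜) + Σ_{n ≥ 1} λ_ψ(n) e(nτ) = ½ Σ_{Q reduced} ψ([𝔞_Q])⁻¹ Σ_{(x,y)} e(τ Q(x,y))`
  (`Im τ > 0`) = Conrey–Iwaniec (2.16)–(2.17) `θ(z;ψ) = Σ_𝒜 ψ(𝒜)θ_𝒜(z) = Σ_{n ≥ 0} λ_ψ(n)e(nz)`,
  `λ_ψ(0) = δ_ψ h/2`, combined with (2.15) `θ_𝒜(z) = ½ Σ_{m,n} e(zφ_𝒜(m,n))` — the starting point of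
  the treatment of `θ(z;ψ)` through binary theta series (by linearity in the class sums).
Conventions: the ideals counted against `Q` form the class `[𝔞_Q]⁻¹` (those with `𝔞_Q𝔞` principal),
whence `ψ([𝔞_Q])⁻¹ = ψ̄([𝔞_Q])`; their lattice sum is that of `(A, −B, C)`, equal to that of `Q` by
`(x, y) ↦ (x, −y)`.

References: [ConreyIwaniec2002] B. Conrey, H. Iwaniec, Acta Arith. 103 (2002) 259–312, §2
(2.14)–(2.18); [Cox2013] D. A. Cox, *Primes of the form x² + ny²*, 2nd ed. (2013), §7.B Thm. 7.7;
[Zagier1981] D. B. Zagier, *Zetafunktionen und quadratische Körper* (1981), §8.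
-/

noncomputable section

open Module NumberField Ideal Complex
open Literature.Barriers.RiemannHypothesis
open Literature.NumberTheory.EllipticCurves
open Literature.NumberTheory.QuadraticFields.BinaryQuadraticForm (reducedForms mem_reducedForms_iff)
open Literature.NumberTheory.LFunctions.NumberField
open scoped nonZeroDivisors

namespace Literature.NumberTheory.QuadraticFields.Quadratic

variable {K : Type*} [Field K] [NumberField K]

/-! ### Two elementary reindexings -/

/-- The lattice sum of a weight is unchanged by `B ↦ −B` (`y ↦ −y`); private. [folklore] -/
private theorem tsum_weight_bqf_neg_snd (f : ℕ → ℂ) (A B C : ℤ) :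
    (∑' p : ℤ × ℤ, f (A * p.1 ^ 2 + -B * p.1 * p.2 + C * p.2 ^ 2).natAbs) =
      ∑' p : ℤ × ℤ, f (A * p.1 ^ 2 + B * p.1 * p.2 + C * p.2 ^ 2).natAbs := by
  rw [← (Equiv.prodCongr (Equiv.refl ℤ) (Equiv.neg ℤ)).tsum_eq
    (fun p : ℤ × ℤ => f (A * p.1 ^ 2 + B * p.1 * p.2 + C * p.2 ^ 2).natAbs)]
  refine tsum_congr fun p => ?_
  simp only [Equiv.prodCongr_apply, Equiv.coe_refl, Prod.map_fst, Prod.map_snd, id_eq,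
    Equiv.neg_apply]
  congr 2
  ring

/-- Summability of the weight along a form is unchanged by `B ↦ −B`; private. [folklore] -/
private theorem summable_weight_bqf_neg_snd (f : ℕ → ℂ) (A B C : ℤ)
    (h : Summable fun p : ℤ × ℤ => f (A * p.1 ^ 2 + B * p.1 * p.2 + C * p.2 ^ 2).natAbs) :
    Summable fun p : ℤ × ℤ => f (A * p.1 ^ 2 + -B * p.1 * p.2 + C * p.2 ^ 2).natAbs := by
  have := (Equiv.prodCongr (Equiv.refl ℤ) (Equiv.neg ℤ)).summable_iff.2 h
  refine this.congr fun p => ?_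
  simp only [Function.comp_apply, Equiv.prodCongr_apply, Equiv.coe_refl, Prod.map_fst,
    Prod.map_snd, id_eq, Equiv.neg_apply]
  congr 2
  ring

/-- `ν_ψ(𝔞) = 1` for a nonzero principal ideal `𝔞` (trivial class); private. [folklore] -/
private theorem classGroupCharIdealHom_eq_one_of_isPrincipal (ψ : ClassGroup (𝓞 K) →* ℂˣ)
    {I : Ideal (𝓞 K)} (hI : I ≠ ⊥) (hP : I.IsPrincipal) : classGroupCharIdealHom ψ I = 1 := by
  rw [classGroupCharIdealHom_apply_of_ne_bot ψ hI,
    (ClassGroup.mk0_eq_one_iff (mem_nonZeroDivisors_of_ne_zero hI)).mpr hP, map_one, Units.val_one]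

/-! ### The twisted sum over all ideals as a sum over the reduced forms -/

/-- **`Σ_𝔞 ψ([𝔞]) f(N𝔞) = ½ Σ_{Q ∈ reducedForms d_K} ψ([𝔞_Q])⁻¹ Σ_{(x,y) ∈ ℤ²} f(Q(x,y))`** for an
imaginary quadratic field with `d_K = t² + 4m < −4`, a class group character `ψ`
(`ν_ψ = classGroupCharIdealHom ψ`, `ν_ψ(0) = 0`) and any weight `f` with `f 0 = 0` absolutely summable
along every reduced form: the nonzero ideals are partitioned by their classes, `[𝔞] = [𝔞_Q]⁻¹` for a
unique reduced `Q = (A, B, C)` (`reducedForms_mk0_bijective`, `ClassGroup.mk0_eq_mk0_inv_iff`), on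
that class `ψ([𝔞]) = ψ([𝔞_Q])⁻¹` (`𝔞_Q𝔞` is principal), and the class sum is
`½ Σ f(Ax² − Bxy + Cy²) = ½ Σ f(Q(x,y))` (`hasSum_indicator_ideal_mul_isPrincipal_weight`; `y ↦ −y`).
The case `f(n) = n^{−s}`, `ψ = 1` is the tree's `dedekindZeta_eq_half_sum_epsteinZeta'`; the general
case is Conrey–Iwaniec's passage (2.16)–(2.18) from `θ(z;ψ) = Σ_𝒜 ψ(𝒜)θ_𝒜(z)` to the Dirichlet
coefficients `λ_ψ(n) = Σ_{N𝔞 = n} ψ(𝔞)` together with (2.15).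
[cite: ConreyIwaniec2002, §2 (2.15)–(2.18)] [cite: Cox2013, §7.B Thm. 7.7] -/
theorem hasSum_classGroupCharIdealHom_mul_weight (b : Basis (Fin 2) ℤ (𝓞 K)) (hb : b 0 = 1)
    {t m : ℤ} (hω : b 1 * b 1 = (m : 𝓞 K) + (t : 𝓞 K) * b 1) (hD : t ^ 2 + 4 * m < -4)
    (ψ : ClassGroup (𝓞 K) →* ℂˣ) {f : ℕ → ℂ} (hf0 : f 0 = 0)
    (hf : ∀ Q ∈ reducedForms (t ^ 2 + 4 * m),
      Summable fun p : ℤ × ℤ => f (Q.1 * p.1 ^ 2 + Q.2.1 * p.1 * p.2 + Q.2.2 * p.2 ^ 2).natAbs) :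
    HasSum (fun I : Ideal (𝓞 K) => classGroupCharIdealHom ψ I * f (absNorm I))
      (1 / 2 * ∑ Q ∈ reducedForms (t ^ 2 + 4 * m),
        (classGroupCharIdealHom ψ
            (span {(Q.1 : 𝓞 K), b 1 - (((Q.2.1 + t) / 2 : ℤ) : 𝓞 K)}))⁻¹ *
          ∑' p : ℤ × ℤ, f (Q.1 * p.1 ^ 2 + Q.2.1 * p.1 * p.2 + Q.2.2 * p.2 ^ 2).natAbs) := by
  classical
  have hneg : t ^ 2 + 4 * m < 0 := by linarith
  set D := t ^ 2 + 4 * m with hDdef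
  -- the ideal of a form, the character on ideals, the summand
  set 𝔞 : ℤ × ℤ × ℤ → Ideal (𝓞 K) := fun Q =>
    span {(Q.1 : 𝓞 K), b 1 - (((Q.2.1 + t) / 2 : ℤ) : 𝓞 K)} with h𝔞
  set ν : Ideal (𝓞 K) → ℂ := fun I => classGroupCharIdealHom ψ I with hν
  set G : Ideal (𝓞 K) → ℂ := fun I => ν I * f (absNorm I) with hG
  have hG0 : G ⊥ = 0 := by simp only [hG, hν, classGroupCharIdealHom_bot, zero_mul]
  -- (1) per reduced form: the class sum, with the constant character value pulled out
  have hclass : ∀ Q ∈ reducedForms D,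
      HasSum (Set.indicator {I | (𝔞 Q * I).IsPrincipal} G)
        ((ν (𝔞 Q))⁻¹ * (1 / 2 *
          ∑' p : ℤ × ℤ, f (Q.1 * p.1 ^ 2 + Q.2.1 * p.1 * p.2 + Q.2.2 * p.2 ^ 2).natAbs)) := by
    intro Q hQ
    obtain ⟨hdisc, hA, -, -⟩ := (mem_reducedForms_iff hneg).1 hQ
    have hd : Q.2.1 ^ 2 - 4 * Q.1 * Q.2.2 = t ^ 2 + 4 * m := hdisc
    set k : ℤ := (Q.2.1 + t) / 2 with hk
    have h2k : 2 * k = Q.2.1 + t := two_mul_ediv_two_of_disc_eq hd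
    have hn : Q.1 * Q.2.2 = k ^ 2 - t * k - m := norm_eq_of_disc_eq hd h2k
    have htk : t - 2 * k = -Q.2.1 := by linarith
    have hf' : Summable fun p : ℤ × ℤ =>
        f (Q.1 * p.1 ^ 2 + (t - 2 * k) * p.1 * p.2 + Q.2.2 * p.2 ^ 2).natAbs := by
      rw [htk]
      exact summable_weight_bqf_neg_snd f _ _ _ (hf Q hQ)
    have h1 := hasSum_indicator_ideal_mul_isPrincipal_weight b hb hω hD hA hn hf0 hf'
    rw [htk, tsum_weight_bqf_neg_snd] at h1
    have h2 := h1.mul_left ((ν (𝔞 Q))⁻¹)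
    -- the character is constant `= ν(𝔞_Q)⁻¹` on the class `[𝔞_Q]⁻¹`
    have h𝔞0 : 𝔞 Q ≠ ⊥ := nonZeroDivisors.ne_zero (formIdeal_mem_nonZeroDivisors b hb hneg ⟨Q, hQ⟩)
    have hν𝔞 : ν (𝔞 Q) ≠ 0 := by
      simp only [hν, classGroupCharIdealHom_apply_of_ne_bot ψ h𝔞0]
      exact Units.ne_zero _
    have hfun : (fun I : Ideal (𝓞 K) => (ν (𝔞 Q))⁻¹ *
        Set.indicator {J : Ideal (𝓞 K) | (span {(Q.1 : 𝓞 K), b 1 - (k : 𝓞 K)} * J).IsPrincipal}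
          (fun J => f (absNorm J)) I) = Set.indicator {I | (𝔞 Q * I).IsPrincipal} G := by
      funext I
      have h𝔞k : span {(Q.1 : 𝓞 K), b 1 - (k : 𝓞 K)} = 𝔞 Q := by simp only [h𝔞, hk]
      rw [h𝔞k]
      by_cases hI : I ∈ {I | (𝔞 Q * I).IsPrincipal}
      · rw [Set.indicator_of_mem hI, Set.indicator_of_mem hI]
        by_cases hI0 : I = ⊥
        · subst hI0
          rw [hG0, Ideal.absNorm_bot, hf0, mul_zero]
        · -- `ν(𝔞_Q) ν(I) = ν(𝔞_Q I) = 1`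
          have hprod : ν (𝔞 Q) * ν I = 1 := by
            have hne : 𝔞 Q * I ≠ ⊥ := by
              rw [Ne, Ideal.mul_eq_bot]; tauto
            rw [hν, ← map_mul]
            exact classGroupCharIdealHom_eq_one_of_isPrincipal ψ hne hI
          have hνI : ν I = (ν (𝔞 Q))⁻¹ := eq_inv_of_mul_eq_one_right hprod
          simp only [hG, hνI]
      · rw [Set.indicator_of_notMem hI, Set.indicator_of_notMem hI, mul_zero]
    rw [hfun] at h2
    exact h2
  -- (2) pointwise: `G I = Σ_Q [𝔞_Q I principal] G I` (exactly one reduced `Q` for `I ≠ 0`)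
  have hbij := reducedForms_mk0_bijective b hb hω hneg
  set Ψ : reducedForms D → _root_.ClassGroup (𝓞 K) := fun Q =>
    ClassGroup.mk0 ⟨_, formIdeal_mem_nonZeroDivisors b hb hneg Q⟩ with hΨ
  have hpt : ∀ I : Ideal (𝓞 K),
      G I = ∑ Q ∈ reducedForms D, Set.indicator {I | (𝔞 Q * I).IsPrincipal} G I := by
    intro I
    by_cases hI : I = ⊥
    · rw [hI, hG0]
      refine (Finset.sum_eq_zero fun Q _ => ?_).symm
      by_cases hmem : (⊥ : Ideal (𝓞 K)) ∈ {I | (𝔞 Q * I).IsPrincipal}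
      · rw [Set.indicator_of_mem hmem, hG0]
      · rw [Set.indicator_of_notMem hmem]
    · have hI0 : I ∈ (Ideal (𝓞 K))⁰ := mem_nonZeroDivisors_of_ne_zero hI
      have hiff : ∀ Q : reducedForms D,
          (𝔞 Q * I).IsPrincipal ↔ Ψ Q = (ClassGroup.mk0 ⟨I, hI0⟩)⁻¹ := by
        intro Q
        rw [hΨ, ClassGroup.mk0_eq_mk0_inv_iff, Submodule.isPrincipal_iff]
        simp only
        constructor
        · rintro ⟨x, hx⟩
          refine ⟨x, ?_, hx⟩
          rintro rfl
          rw [Submodule.span_zero_singleton] at hx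
          exact (mul_ne_zero (nonZeroDivisors.ne_zero
            (formIdeal_mem_nonZeroDivisors b hb hneg Q)) hI) hx
        · rintro ⟨x, -, hx⟩
          exact ⟨x, hx⟩
      obtain ⟨Q₀, hQ₀, huniq⟩ : ∃! Q : reducedForms D, Ψ Q = (ClassGroup.mk0 ⟨I, hI0⟩)⁻¹ :=
        (Function.bijective_iff_existsUnique Ψ).1 hbij _
      rw [Finset.sum_eq_single (Q₀ : ℤ × ℤ × ℤ)]
      · rw [Set.indicator_of_mem]
        exact (hiff Q₀).2 hQ₀
      · intro Q hQ hne
        rw [Set.indicator_of_notMem]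
        intro hmem
        have h1 := (hiff ⟨Q, hQ⟩).1 hmem
        exact hne (congrArg Subtype.val (huniq ⟨Q, hQ⟩ h1))
      · intro h
        exact absurd Q₀.2 h
  -- (3) sum the class sums over the reduced forms
  have hsum := hasSum_sum hclass
  have hfunG : (fun I : Ideal (𝓞 K) =>
      ∑ Q ∈ reducedForms D, Set.indicator {I | (𝔞 Q * I).IsPrincipal} G I) = G :=
    funext fun I => (hpt I).symm
  rw [hfunG] at hsum
  have hval : (∑ Q ∈ reducedForms D, (ν (𝔞 Q))⁻¹ * (1 / 2 *
      ∑' p : ℤ × ℤ, f (Q.1 * p.1 ^ 2 + Q.2.1 * p.1 * p.2 + Q.2.2 * p.2 ^ 2).natAbs)) =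
      1 / 2 * ∑ Q ∈ reducedForms D, (ν (𝔞 Q))⁻¹ *
        ∑' p : ℤ × ℤ, f (Q.1 * p.1 ^ 2 + Q.2.1 * p.1 * p.2 + Q.2.2 * p.2 ^ 2).natAbs := by
    rw [Finset.mul_sum]
    refine Finset.sum_congr rfl fun Q _ => ?_
    ring
  rw [hval] at hsum
  exact hsum

/-! ### Regrouping by the norm: the Dirichlet coefficients `λ_ψ(n) = Σ_{N𝔞 = n} ψ(𝔞)` -/

/-- **`Σ_{n ≥ 1} λ_ψ(n) f(n) = ½ Σ_{Q ∈ reducedForms d_K} ψ([𝔞_Q])⁻¹ Σ_{(x,y) ∈ ℤ²} f(Q(x,y))`** with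
`λ_ψ(n) = Σ_{N𝔞 = n} ψ(𝔞)` (`twistCount K (classGroupCharIdealHom ψ) n`, Conrey–Iwaniec (2.18);
`λ_ψ(0)·f(0) = 0`): `hasSum_classGroupCharIdealHom_mul_weight` regrouped along the fibres of the norm
(each finite, `idealsOfNorm K n`). [cite: ConreyIwaniec2002, §2 (2.15)–(2.18)] -/
theorem hasSum_twistCount_mul_weight (b : Basis (Fin 2) ℤ (𝓞 K)) (hb : b 0 = 1)
    {t m : ℤ} (hω : b 1 * b 1 = (m : 𝓞 K) + (t : 𝓞 K) * b 1) (hD : t ^ 2 + 4 * m < -4)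
    (ψ : ClassGroup (𝓞 K) →* ℂˣ) {f : ℕ → ℂ} (hf0 : f 0 = 0)
    (hf : ∀ Q ∈ reducedForms (t ^ 2 + 4 * m),
      Summable fun p : ℤ × ℤ => f (Q.1 * p.1 ^ 2 + Q.2.1 * p.1 * p.2 + Q.2.2 * p.2 ^ 2).natAbs) :
    HasSum (fun n : ℕ => twistCount K (classGroupCharIdealHom ψ) n * f n)
      (1 / 2 * ∑ Q ∈ reducedForms (t ^ 2 + 4 * m),
        (classGroupCharIdealHom ψ
            (span {(Q.1 : 𝓞 K), b 1 - (((Q.2.1 + t) / 2 : ℤ) : 𝓞 K)}))⁻¹ *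
          ∑' p : ℤ × ℤ, f (Q.1 * p.1 ^ 2 + Q.2.1 * p.1 * p.2 + Q.2.2 * p.2 ^ 2).natAbs) := by
  classical
  have h := hasSum_classGroupCharIdealHom_mul_weight b hb hω hD ψ hf0 hf
  have hfib := h.tsum_fiberwise (fun I : Ideal (𝓞 K) => absNorm I)
  have hfun : (fun n : ℕ => ∑' I : ↥((fun I : Ideal (𝓞 K) => absNorm I) ⁻¹' {n}),
      classGroupCharIdealHom ψ (I : Ideal (𝓞 K)) * f (absNorm (I : Ideal (𝓞 K)))) =
      fun n : ℕ => twistCount K (classGroupCharIdealHom ψ) n * f n := by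
    funext n
    have hset : ((fun I : Ideal (𝓞 K) => absNorm I) ⁻¹' {n}) =
        ((idealsOfNorm K n : Finset (Ideal (𝓞 K))) : Set (Ideal (𝓞 K))) := by
      ext I
      simp [mem_idealsOfNorm]
    rw [tsum_congr_set_coe (fun I : Ideal (𝓞 K) => classGroupCharIdealHom ψ I * f (absNorm I)) hset,
      Finset.tsum_subtype' (idealsOfNorm K n)
        (fun I : Ideal (𝓞 K) => classGroupCharIdealHom ψ I * f (absNorm I)),
      twistCount, Finset.sum_mul]
    refine Finset.sum_congr rfl fun I hI => ?_
    rw [mem_idealsOfNorm.mp hI]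
  rw [hfun] at hfib
  exact hfib

/-! ### The constant terms -/

/-- **`Σ_{Q ∈ reducedForms d_K} ψ([𝔞_Q])⁻¹ = Σ_{𝒜 ∈ Cl(K)} ψ(𝒜)`** (`= h` if `ψ = 1`, `= 0` otherwise):
`Q ↦ [𝔞_Q]` is a bijection onto `Cl(K)` (`reducedForms_mk0_bijective`) and `𝒜 ↦ 𝒜⁻¹` permutes
`Cl(K)`. This identifies the constant term `λ_ψ(0) = ½Σ_𝒜ψ(𝒜) = δ_ψ h/2` of (2.17) with the sum of
the constant terms `½` of the binary theta series (2.15). [cite: ConreyIwaniec2002, §2 (2.13)–(2.17)] -/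
theorem sum_reducedForms_inv_classGroupCharIdealHom (b : Basis (Fin 2) ℤ (𝓞 K)) (hb : b 0 = 1)
    {t m : ℤ} (hω : b 1 * b 1 = (m : 𝓞 K) + (t : 𝓞 K) * b 1) (hneg : t ^ 2 + 4 * m < 0)
    (ψ : ClassGroup (𝓞 K) →* ℂˣ) :
    (∑ Q ∈ reducedForms (t ^ 2 + 4 * m),
        (classGroupCharIdealHom ψ
          (span {(Q.1 : 𝓞 K), b 1 - (((Q.2.1 + t) / 2 : ℤ) : 𝓞 K)}))⁻¹) =
      ∑ c : ClassGroup (𝓞 K), (ψ c : ℂ) := by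
  classical
  set D := t ^ 2 + 4 * m with hDdef
  have hbij := reducedForms_mk0_bijective b hb hω hneg
  set Ψ : reducedForms D → _root_.ClassGroup (𝓞 K) := fun Q =>
    ClassGroup.mk0 ⟨_, formIdeal_mem_nonZeroDivisors b hb hneg Q⟩ with hΨ
  rw [← Finset.sum_coe_sort]
  have hterm : ∀ Q : reducedForms D,
      (classGroupCharIdealHom ψ
          (span {((Q : ℤ × ℤ × ℤ).1 : 𝓞 K),
            b 1 - ((((Q : ℤ × ℤ × ℤ).2.1 + t) / 2 : ℤ) : 𝓞 K)}))⁻¹ = (ψ (Ψ Q)⁻¹ : ℂ) := by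
    intro Q
    rw [map_inv, Units.val_inv_eq_inv_val, hΨ, ← classGroupCharIdealHom_coe ψ]
  simp only [hterm]
  rw [hbij.sum_comp (fun c : _root_.ClassGroup (𝓞 K) => (ψ c⁻¹ : ℂ))]
  exact Fintype.sum_equiv (Equiv.inv (_root_.ClassGroup (𝓞 K))) _ _ fun c => rfl

/-! ### The class-group theta series as a sum of binary theta series -/

/-- The theta weight along a positive definite form: with `f(n) = e(nτ)` for `n ≥ 1`, `f(0) = 0`,
the lattice sum is the binary theta series minus its constant term,
`Σ_{(x,y)} f(Q(x,y)) = Σ_{(x,y)} e(τQ(x,y)) − 1`, absolutely convergent (`summable_cexp_mul_bqf`).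
Private bookkeeping for `half_sum_add_tsum_twistCount_cexp_eq`. [folklore] -/
private theorem tsum_thetaWeight_bqf {A B C : ℤ} (hA : 0 < A) (hdisc : B ^ 2 - 4 * A * C < 0)
    {τ : ℂ} (hτ : 0 < τ.im) :
    (Summable fun p : ℤ × ℤ =>
      (fun n : ℕ => if n = 0 then (0 : ℂ) else cexp (2 * Real.pi * I * τ * (n : ℂ)))
        (A * p.1 ^ 2 + B * p.1 * p.2 + C * p.2 ^ 2).natAbs) ∧
    (∑' p : ℤ × ℤ,
      (fun n : ℕ => if n = 0 then (0 : ℂ) else cexp (2 * Real.pi * I * τ * (n : ℂ)))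
        (A * p.1 ^ 2 + B * p.1 * p.2 + C * p.2 ^ 2).natAbs) =
      (∑' p : ℤ × ℤ, cexp (2 * Real.pi * I * τ * ((A * p.1 ^ 2 + B * p.1 * p.2 + C * p.2 ^ 2 : ℤ) : ℂ)))
        - 1 := by
  classical
  set f : ℕ → ℂ := fun n => if n = 0 then 0 else cexp (2 * Real.pi * I * τ * (n : ℂ)) with hf
  have hpos : IsPosDefForm (A : ℝ) (B : ℝ) (C : ℝ) :=
    ⟨by exact_mod_cast hA, by exact_mod_cast hdisc⟩
  set g : ℤ × ℤ → ℂ := fun p => cexp (2 * Real.pi * I * τ *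
      ((A * p.1 ^ 2 + B * p.1 * p.2 + C * p.2 ^ 2 : ℤ) : ℂ)) with hg
  have hgsum : Summable g := summable_cexp_mul_bqf hA hdisc hτ
  have hfg : ∀ p : ℤ × ℤ,
      f (A * p.1 ^ 2 + B * p.1 * p.2 + C * p.2 ^ 2).natAbs = if p = 0 then 0 else g p := by
    intro p
    by_cases hp : p = 0
    · subst hp
      simp [hf]
    · have hQ : 0 < bqfEval (A : ℝ) (B : ℝ) (C : ℝ) p := hpos.eval_pos hp
      have hQeq : bqfEval (A : ℝ) (B : ℝ) (C : ℝ) p =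
          ((A * p.1 ^ 2 + B * p.1 * p.2 + C * p.2 ^ 2 : ℤ) : ℝ) := by
        unfold bqfEval; push_cast; ring
      rw [hQeq] at hQ
      have hQ' : 0 < A * p.1 ^ 2 + B * p.1 * p.2 + C * p.2 ^ 2 := by exact_mod_cast hQ
      have hne : (A * p.1 ^ 2 + B * p.1 * p.2 + C * p.2 ^ 2).natAbs ≠ 0 :=
        Int.natAbs_ne_zero.mpr hQ'.ne'
      rw [if_neg hp, hf]
      simp only [hne, if_false, hg]
      congr 2
      rw [← Int.cast_natCast, Int.natAbs_of_nonneg hQ'.le]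
  have hupd : (fun p : ℤ × ℤ => if p = 0 then 0 else g p) = Function.update g 0 0 := by
    funext p
    rw [Function.update_apply]
  have hsum' : Summable fun p : ℤ × ℤ => if p = 0 then 0 else g p := by
    rw [hupd]
    exact hgsum.update 0 0
  refine ⟨hsum'.congr fun p => (hfg p).symm, ?_⟩
  rw [tsum_congr hfg, hgsum.tsum_eq_add_tsum_ite 0]
  have hg0 : g 0 = 1 := by simp [hg]
  rw [hg0]
  ring

/-- **The class-group theta series as a sum of binary theta series (Conrey–Iwaniec (2.15)–(2.17))**:
for an imaginary quadratic field with `d_K = t² + 4m < −4`, a class group character `ψ`, and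
`Im τ > 0`,
`½ Σ_{𝒜 ∈ Cl(K)} ψ(𝒜) + Σ_{n ≥ 1} λ_ψ(n) e(nτ) = ½ Σ_{Q ∈ reducedForms d_K} ψ([𝔞_Q])⁻¹ Σ_{(x,y) ∈ ℤ²} e(τQ(x,y))`
with `λ_ψ = twistCount K (classGroupCharIdealHom ψ)` — print: "`θ(z;ψ) = Σ_𝒜 ψ(𝒜)θ_𝒜(z)` (2.16) …
has the Fourier expansion `θ(z;ψ) = Σ_{n≥0} λ_ψ(n)e(nz)` (2.17) … with `λ_ψ(0) = δ_ψ h/2`",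
"`θ_𝒜(z) = ½ Σ_m Σ_n e(zφ_𝒜(m,n))`" (2.15). The left side is `θ(τ;ψ)` through (2.17) (the `n ≥ 1`
sum shifted to `n + 1`), the right side is `Σ_𝒜 ψ(𝒜)θ_𝒜` through (2.15) with the classes
enumerated by the reduced forms (`[𝔞] = [𝔞_Q]⁻¹`, whence `ψ([𝔞_Q])⁻¹`).
[cite: ConreyIwaniec2002, §2 (2.15)–(2.17)] -/
theorem half_sum_add_tsum_twistCount_cexp_eq (b : Basis (Fin 2) ℤ (𝓞 K)) (hb : b 0 = 1)
    {t m : ℤ} (hω : b 1 * b 1 = (m : 𝓞 K) + (t : 𝓞 K) * b 1) (hD : t ^ 2 + 4 * m < -4)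
    (ψ : ClassGroup (𝓞 K) →* ℂˣ) {τ : ℂ} (hτ : 0 < τ.im) :
    1 / 2 * (∑ c : ClassGroup (𝓞 K), (ψ c : ℂ)) +
        ∑' n : ℕ, twistCount K (classGroupCharIdealHom ψ) (n + 1) *
          cexp (2 * Real.pi * I * τ * ((n : ℂ) + 1)) =
      1 / 2 * ∑ Q ∈ reducedForms (t ^ 2 + 4 * m),
        (classGroupCharIdealHom ψ
            (span {(Q.1 : 𝓞 K), b 1 - (((Q.2.1 + t) / 2 : ℤ) : 𝓞 K)}))⁻¹ *
          ∑' p : ℤ × ℤ, cexp (2 * Real.pi * I * τ *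
            ((Q.1 * p.1 ^ 2 + Q.2.1 * p.1 * p.2 + Q.2.2 * p.2 ^ 2 : ℤ) : ℂ)) := by
  classical
  have hneg : t ^ 2 + 4 * m < 0 := by linarith
  set D := t ^ 2 + 4 * m with hDdef
  set f : ℕ → ℂ := fun n => if n = 0 then 0 else cexp (2 * Real.pi * I * τ * (n : ℂ)) with hf
  have hf0 : f 0 = 0 := by simp [hf]
  have hred : ∀ Q ∈ reducedForms D, 0 < Q.1 ∧ Q.2.1 ^ 2 - 4 * Q.1 * Q.2.2 < 0 := by
    intro Q hQ
    obtain ⟨hdisc, hA, -, -⟩ := (mem_reducedForms_iff hneg).1 hQ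
    have hd : Q.2.1 ^ 2 - 4 * Q.1 * Q.2.2 = t ^ 2 + 4 * m := hdisc
    exact ⟨hA, by rw [hd]; exact hneg⟩
  have hfsum : ∀ Q ∈ reducedForms D,
      Summable fun p : ℤ × ℤ => f (Q.1 * p.1 ^ 2 + Q.2.1 * p.1 * p.2 + Q.2.2 * p.2 ^ 2).natAbs :=
    fun Q hQ => (tsum_thetaWeight_bqf (hred Q hQ).1 (hred Q hQ).2 hτ).1
  have h := hasSum_twistCount_mul_weight b hb hω hD ψ hf0 hfsum
  -- left side: drop the vanishing `n = 0` term and shift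
  have hL : (∑' n : ℕ, twistCount K (classGroupCharIdealHom ψ) (n + 1) *
      cexp (2 * Real.pi * I * τ * ((n : ℂ) + 1))) =
      ∑' n : ℕ, twistCount K (classGroupCharIdealHom ψ) n * f n := by
    rw [h.summable.tsum_eq_zero_add]
    rw [hf0, mul_zero, zero_add]
    refine tsum_congr fun n => ?_
    simp only [hf, Nat.succ_ne_zero n, if_false]
    push_cast
    ring_nf
  -- right side: each lattice sum is the binary theta series minus `1`
  have hR : ∀ Q ∈ reducedForms D,
      (∑' p : ℤ × ℤ, f (Q.1 * p.1 ^ 2 + Q.2.1 * p.1 * p.2 + Q.2.2 * p.2 ^ 2).natAbs) =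
        (∑' p : ℤ × ℤ, cexp (2 * Real.pi * I * τ *
          ((Q.1 * p.1 ^ 2 + Q.2.1 * p.1 * p.2 + Q.2.2 * p.2 ^ 2 : ℤ) : ℂ))) - 1 :=
    fun Q hQ => (tsum_thetaWeight_bqf (hred Q hQ).1 (hred Q hQ).2 hτ).2
  have hconst := sum_reducedForms_inv_classGroupCharIdealHom b hb hω hneg ψ
  rw [hL, h.tsum_eq, ← hconst, Finset.mul_sum, Finset.mul_sum, ← Finset.sum_add_distrib,
    Finset.mul_sum]
  refine Finset.sum_congr rfl fun Q hQ => ?_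
  rw [hR Q hQ]
  ring

end Literature.NumberTheory.QuadraticFields.Quadratic

end
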